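import Summits.BirchSwinnertonDyer.BirchSwinnertonDyer.Theses.SignedBaseChange
import Literature.NumberTheory.EllipticCurves.BurungaleSkinnerTianWan2024.GreenbergBDPComparisonSupersingularPRE
import Literature.NumberTheory.EllipticCurves.BurungaleCastellaSkinner2025.BDPMainConjecture
import Literature.NumberTheory.EllipticCurves.SupersingularDensitySerreFrobeniusProofs
import Literature.NumberTheory.EllipticCurves.NonEisensteinPrimeOfSurjective
import Summits.BirchSwinnertonDyer.Rank1Residual.Partition.IrreducibleOverQuadraticField
import HarnessLib

/-!
# Stub S3 `stub_minusIsBDP` of line `bdpline` on the crux `AnticyclotomicEisensteinDivisibility`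
# (stmt-BirchSwinnertonDyer-20727, route SignedBaseChange) — the SUPERSINGULAR form ("`G⁻` IS a BDP
# `L`-function" at `a_p = 0`), closed modulo TWO named facts instead of three (helper for stmt-BirchSwinnertonDyer-20727)

Extra width seat bsd-line-sbc-p1-w3 (gen 0). The registered stub `stub_minusIsBDP` (v18) is stated for EVERY
good `p ≥ 5` and is closed modulo {Yan–Zhu Prop. 3.14 (guarded, ordinary `p`), BSTW24 Prop. 6.27 (i) (PRE,
supersingular `p`), BCS25 Prop. 4.2.2 (a BDP frame exists)} by `SignedBaseChangeAcDivMinusIsBDP.stub_minusIsBDP_of_facts`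
(p553754). In the composition `Bdpline.AnticyclotomicEisensteinDivisibility_of` the stub is consumed ONLY on the
supersingular branch (after `by_cases hap : ¬ p ∣ a_p`, the ordinary branch being `stub_ordSlice`), where
`a_p = 0` is in context — so the ordinary comparison (Yan–Zhu Prop. 3.14) is an IDLE hypothesis of the crux's
conditional closure. This file records the stub's text WITH the binder `W.frobeniusTrace p = 0` inserted after
`W.HasGoodReductionAtPrime p` (the binder order of the sibling stub `stub_xAcTorsionSS`), closed modulo the two
facts the supersingular branch actually uses. For the LEAD's reshape (v19+): restating `stub_minusIsBDP` in this
form drops one named fact from the crux's ledger. Theorems only; nothing asserted about elliptic curves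
unconditionally (the two facts are hypotheses; the supersingular one is a claim-tagged OPEN/PRE binder); no
summit statement / BSD is proved by this file.
-/

-- D-0017: single-problem summit, the namespace repeats the problem name by design.
set_option linter.dupNamespace false
set_option autoImplicit false

noncomputable section

namespace Summit.BirchSwinnertonDyer.BirchSwinnertonDyer.Theorems.SignedBaseChangeAcDivMinusIsBDPSS

open Summit.BirchSwinnertonDyer.BirchSwinnertonDyer.Theses.SignedBaseChange
open NumberField IsDedekindDomain Field CongruenceSubgroup
  Literature.NumberTheory.EllipticCurves Literature.NumberTheory.EllipticCurves.YanZhu2026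
  Literature.NumberTheory.EllipticCurves.BurungaleCastellaSkinner2025
  Literature.NumberTheory.EllipticCurves.BurungaleSkinnerTianWan2024
  Literature.NumberTheory.EllipticCurves.Rank1Residual

/-- **Stub S3 `stub_minusIsBDP` at a good SUPERSINGULAR prime (`a_p = 0`), modulo two named facts**:
BSTW24 Prop. 6.27 (i) (PRE binder: the comparison `(G⁻) = (J₀ L)` for every Greenberg frame and every BDP
frame) and BCS25 Prop. 4.2.2 (a BDP frame with `μ = 0` exists; (irr_K) from `Surj`). The registered text with
`W.frobeniusTrace p = 0 →` inserted after `W.HasGoodReductionAtPrime p →`; `p ∤ N_E` from good reduction.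
[cite: BurungaleCastellaSkinner2025, Prop. 4.2.2 (§4.2, pp. 8–9 of arXiv:2405.00270v2)]
[claim: BurungaleSkinnerTianWan2024, status: under-review] -/
theorem stub_minusIsBDP_ss_of_facts
    (h627 : prop627_span_minus_eq_span_bdp_supersingular_PRE)
    (h422e : prop422_exists_isBDPLFunction_mu_eq_zero) :
    SignedTwoVariableInputs → Literature.NumberTheory.EllipticCurves.ModularForms.nonempty_modularParametrizationData → ∀ (W : WeierstrassCurve ℚ) [W.IsElliptic] [W.IsGloballyMinimal] (p : ℕ) [Fact p.Prime], 5 ≤ p → W.HasGoodReductionAtPrime p → W.frobeniusTrace p = 0 → Literature.NumberTheory.EllipticCurves.Rank1Residual.Surj W p → ∀ (K : Type) [Field K] [NumberField K] (ι : PadicAlgCl p ≃+* ℂ) (v vbar : IsDedekindDomain.HeightOneSpectrum (NumberField.RingOfIntegers K)) (κ₁ κ₂ : Literature.NumberTheory.EllipticCurves.ZpExtension K p) (γ₁ γ₂ : Field.absoluteGaloisGroup K) [Fact (Literature.NumberTheory.EllipticCurves.ZpExtension.IsTopGeneratorPair κ₁ κ₂ γ₁ γ₂)] [NeZero (NumberField.discr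 K).natAbs] (N : ℕ) [NeZero N] (f : CuspForm (CongruenceSubgroup.Gamma0 N) 2), Literature.NumberTheory.EllipticCurves.ModularForms.IsNewformOf W f → (N : ℤ) = W.conductorNorm ℤ → Literature.NumberTheory.EllipticCurves.IsImaginaryQuadratic K → ((Ideal.span {(p : ℤ)}).primesOver (NumberField.RingOfIntegers K)).ncard = 2 → ((p : ℕ) : NumberField.RingOfIntegers K) ∈ v.asIdeal → ((p : ℕ) : NumberField.RingOfIntegers K) ∈ vbar.asIdeal → vbar ≠ v → (∀ (w : NumberField.InfinitePlace K) (k : NumberField.RingOfIntegers K), k ∈ v.asIdeal ↔ ‖ι.symm (w.embedding (k : K))‖ < 1) → IsCoprime (N : ℤ) (NumberField.discr K) → (∀ ℓ : ℕ, ℓ.Prime → ℓ ∣ N → ((Ideal.span {(ℓ : ℤ)}).primesOver (NumberField.RingOfIntegers K)).ncard = 2) → Odd (NumberField.discr K) → NumberField.discr K ≠ -3 → κ₁.IsCyclotomic → κ₂.IsAnticyclotomic → ∀ (Ω δ : ℂ) (Ωp : (Literature.NumberTheory.EllipticCurves.unrIntegers p)ˣ) (LK G : PowerSeries (PowerSeries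 (PadicComplexInt p))), Ω ≠ 0 → (δ ^ 2 = (NumberField.discr K : ℂ) ∨ δ ^ 2 = -(NumberField.discr K : ℂ)) → Literature.NumberTheory.EllipticCurves.IsKatzMeasure₂ ι v vbar ∅ κ₁ κ₂ γ₁⁻¹ γ₂⁻¹ 1 Ω δ ((Ωp : Literature.NumberTheory.EllipticCurves.unrIntegers p) : PadicComplex p) LK → Literature.NumberTheory.EllipticCurves.IsGreenbergLFunctionAnyRoot₂ ι v vbar κ₁ κ₂ γ₁⁻¹ γ₂⁻¹ f (NumberField.discr K).natAbs (NumberField.classNumber K) LK G → ∃ (ΩK : ℂ) (Ωp' : (Literature.NumberTheory.EllipticCurves.unrIntegers p)ˣ) (L : Literature.NumberTheory.EllipticCurves.UnrSeries p), ΩK ≠ 0 ∧ Literature.NumberTheory.EllipticCurves.IsBDPLFunction ι v κ₂ γ₂ f ΩK ((Ωp' : Literature.NumberTheory.EllipticCurves.unrIntegers p) : PadicComplex p) L ∧ ∀ (J₀ : Literature.NumberTheory.EllipticCurves.unrIntegers p →+* PadicComplexInt p), (∀ x : Literature.NumberTheory.EllipticCurves.unrIntegers p, ((J₀ x : PadicComplexInt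 p) : PadicComplex p) = (x : PadicComplex p)) → Ideal.span {Literature.NumberTheory.EllipticCurves.UnrSeries₂.minus G} = Ideal.span {PowerSeries.map J₀ L} := by
  intro _ _ W _ _ p _ hp hgood ha0 hs K _ _ ι v vbar κ₁ κ₂ γ₁ γ₂ _ _ N _ f hf hN hK hsplit hv hvbar hvv hι hcop hHeeg
    hodd hne3 hκ₁ hκ₂ Ω δ Ωp LK G hΩ hδ hLK hG
  have hirr : (W.baseChange K).HasIrreducibleModPGaloisRep p :=
    Summit.BirchSwinnertonDyer.Rank1Residual.irrK_of_surj W p hs K hK.1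
  -- a BDP frame at the good prime `p` (BCS25 Prop. 4.2.2 / Hsieh Thm. B)
  obtain ⟨ΩK, Ωp', L, hΩK, hL, -⟩ := h422e ι W K v κ₂ γ₂ hf (by omega) hgood hK hHeeg hsplit hodd hne3 hirr hv hι hκ₂
    (isTopGenerator_of_pair (κ₁ := κ₁) (γ₁ := γ₁))
  refine ⟨ΩK, Ωp', L, hΩK, hL, fun J₀ hJ₀ ↦ ?_⟩
  -- supersingular: `p ∤ N_E` from good reduction; BSTW24 Prop. 6.27 (i)
  have hpN : ¬ (p : ℤ) ∣ W.conductorNorm ℤ := by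
    intro h
    exact not_dvd_conductorNorm_of_hasGoodReductionAtPrime W hgood (by exact_mod_cast h)
  exact h627 ι W K v vbar κ₁ κ₂ γ₁ γ₂ hf hN hp hpN ha0 hK hsplit hv hvbar hvv hι hcop hHeeg hodd hne3 hκ₁ hκ₂
    Ω δ Ωp LK G hΩ hδ hLK hG ΩK Ωp' L hΩK hL J₀ hJ₀

end Summit.BirchSwinnertonDyer.BirchSwinnertonDyer.Theorems.SignedBaseChangeAcDivMinusIsBDPSS

end
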